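import Literature.Topology.FourManifolds.SPC4HandlesThmAImpliesCerf
import Literature.Topology.FourManifolds.SPC4HandlesThmALift
import HarnessLib

/-!
# Laudenbach–Poénaru's extension theorem in genus zero is exactly Cerf's `Γ₄ = 0`

Topic `Literature/Topology/FourManifolds`; review certificate for the named fact
`Literature.Topology.FourManifolds.laudenbachPoenaru_diffeoExtends_of_isOrientationPreserving`
(**h₂** of `SPC4HandlesProofs.lean`: Laudenbach–Poénaru, *A note on 4-dimensional
handlebodies*, Bull. SMF 100 (1972), §2, proof of Thm. A, orientation-preserving case,
pp. 341–342 — an orientation-preserving self-diffeomorphism of the boundary of a compact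
connected orientable `4`-dimensional `1`-handlebody `V`, fixing a base point and inducing the
identity of `π₁(∂V)`, extends over `V`).  Everything here is **proved**; no definition, no
notation and no named fact is introduced.

`SPC4HandlesThmAImpliesCerf.lean` shows that h₂ (universe `0`) implies Cerf's theorem
`Γ₄ = 0` in extension form, the named fact
`Literature.Topology.FourManifolds.cerf_diffeomorph_sphere_three_extends_ball` (Cerf, LNM 53
(1968), Introduction and Ch. I §1, Théorème 1 with Corollaire 1), by evaluating h₂ at `V = 𝔻⁴`.
This file sharpens that certificate to an **equivalence on the genus-zero slice**, in the
handle vocabulary of the tree (`HasHandleDecomposition 3 V (handleCount 1 0)`: one `0`-handle,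
no `1`-handle — the case `p = 0`, `Y_0 = D⁴`, of Laudenbach–Poénaru, for which Thm. A reads
`D⁴ ∪_h D⁴ ≅ S⁴`, i.e. `Γ₄ = 0`):

* `BoundaryData.diffeoExtends_of_handleCount_one_zero_of_cerf` (§1): **`Γ₄ = 0` implies the
  full extension theorem in genus zero, in every universe** — every self-diffeomorphism of the
  boundary of every compact connected orientable smooth `4`-manifold with a handle decomposition
  of type `(1, 0)` extends over it.  Proof: such a `V` is diffeomorphic to the lifted ball
  `ULift 𝔻⁴` by the discharged classification UNIQ₄
  (`nonempty_diffeomorph_of_hasHandleDecomposition_handleCount_one_of_oneHandle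
  oneHandle_nonempty_diffeomorph_holds`; Kosinski (1993), VI (6.6), (11.4)(c)) and the handle
  decomposition `‖x‖²` of `𝔻⁴` (`hasHandleDecomposition_closedBall`); a boundary diffeomorphism
  `ψ` of `V` is conjugated to one of `𝕊³` (`BoundaryData.restrictDiffeomorph`,
  `ManifoldULift.diffeomorph`), extended over `𝔻⁴` by `Γ₄ = 0`, lifted
  (`BoundaryData.DiffeoExtends.ulift`) and conjugated back (`BoundaryData.DiffeoExtends.conj`).
* `cerf_diffeomorph_sphere_three_extends_ball_of_forall_apply_eq` (§2): Cerf's own reduction of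
  the orientation-free statement of his Introduction to the based orientation-preserving case —
  if every self-diffeomorphism of `𝕊³` preserving every smooth orientation and fixing a point
  extends over `𝔻⁴`, then every self-diffeomorphism of `𝕊³` does (base point restored by a
  diffeomorphism diffeotopic to the identity, Hirsch Ch. 8 Thm. 3.1, which extends by Cerf's
  Lemme 2, `ExtendsOverBall.of_isDiffeotopicToId`; orientation restored by a hyperplane
  reflection, which extends linearly, `extendsOverBall_sphereReflection`).  This is the argument
  of `cerf_diffeomorph_sphere_three_extends_ball_of_laudenbachPoenaru_diffeoExtends`
  (`SPC4HandlesThmAImpliesCerf.lean`) with its hypothesis h₂ weakened to what is used.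
* `cerf_diffeomorph_sphere_three_extends_ball_of_genusZero` (§3): the genus-zero slice of h₂ in
  universe `0` implies `Γ₄ = 0` (evaluate at `𝔻⁴`, `π₁(𝕊³) = 1`).
* `cerf_iff_laudenbachPoenaru_diffeoExtends_genusZero`,
  `cerf_iff_diffeoExtends_genusZero` (§3): **`Γ₄ = 0` ⟺ h₂ in genus zero ⟺ the full
  Laudenbach–Poénaru extension fact `exists_diffeomorph_comp_incl_eq` (spc4.S24 (c)) in genus
  zero** (universe `0`, the universe of `𝔻⁴ ⊂ ℝ⁴`; §1 gives the forward directions in every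
  universe).

Consequently the tree's obligation h₂ (equivalently THMAᴹ,
`laudenbachPoenaru_diffeoExtends_of_isOrientationPreserving_iff_oneHandlebody` of
`SPC4HandlesThmALift.lean`) splits as: genus `0` = Cerf's `Γ₄ = 0` exactly (this file); genus
`p ≥ 1` = Laudenbach–Poénaru's argument proper (Lemma 3, p. 340; Laudenbach, *Sur les
2-sphères d'une variété de dimension 3*, Ann. of Math. 97 (1973), §5, 5.3–5.4 — which again
uses `Γ₄ = 0`).

## References

* F. Laudenbach, V. Poénaru, *A note on 4-dimensional handlebodies*, Bull. Soc. Math. France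
  100 (1972), 337–344: Thm. A (p. 337) and its proof, §2, pp. 341–342 ("mark that no
  diffeomorphism of `X_p` was needed here!").  Held: `lit read doi-10-24033-bsmf-1741`.
  [LaudenbachPoenaruBSMF1972]
* J. Cerf, *Sur les difféomorphismes de la sphère de dimension trois (Γ₄ = 0)*, Lecture Notes
  in Math. 53, Springer (1968): Introduction (2nd paragraph) and Ch. I §1, Lemme 2, Théorème 1,
  Corollaire 1. [CerfDiffeoSphere1968]
* A. A. Kosinski, *Differential Manifolds* (1993), VI (6.6), (11.4)(c). [Kosinski1993]
* M. W. Hirsch, *Differential Topology*, GTM 33 (1976), Ch. 4 §4; Ch. 8 §3, Thm. 3.1.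
  [HirschDT1976]
* A. Hatcher, *Algebraic Topology* (2002), Prop. 1.14. [HatcherAT2002]

## Design notes

* Only theorems are added; the sphere and the ball are written
  `Metric.sphere (0 : EuclideanSpace ℝ (Fin 4)) 1` and
  `Metric.closedBall (0 : EuclideanSpace ℝ (Fin 4)) 1` (no notation), as in
  `SPC4HandlesThmAImpliesCerf.lean`; in the prose they are `𝕊³`, `𝔻⁴`.
* The genus-zero slices of h₂ and of `exists_diffeomorph_comp_incl_eq` are written out inside
  the statements of §3 (no `def … : Prop` is introduced for them); they are the bodies of the
  two named facts with the binder `IsHandlebodyOfIndexLE 3 1 V` replaced by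
  `HasHandleDecomposition 3 V (handleCount 1 0)`.
-/

open scoped Manifold ContDiff Topology
open Set Function Metric

noncomputable section

namespace Literature.Topology.FourManifolds

universe u

/-! ### §1 From `Γ₄ = 0` to the extension theorem in genus zero (every universe) -/

/-- **`Γ₄ = 0` implies Laudenbach–Poénaru's extension theorem in genus zero, for every boundary
diffeomorphism and in every universe.**  Let `V` be a compact connected orientable smooth
`4`-manifold with boundary carrying a handle decomposition with one `0`-handle and no
`1`-handle (`HasHandleDecomposition 3 V (handleCount 1 0)`), `b` a boundary datum and `ψ` any
self-diffeomorphism of `b.carrier ≅ ∂V`.  If every self-diffeomorphism of `S³` extends over `D⁴`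
(`cerf_diffeomorph_sphere_three_extends_ball`, Cerf (1968), Cor. 1), then `ψ` extends over `V`:
`V ≅ ULift 𝔻⁴` by the classification of orientable `4`-dimensional `1`-handlebodies of type
`(1, 0)` (UNIQ₄, discharged: Kosinski (1993), VI (6.6), (11.4)(c)), the conjugate of `ψ` on `𝕊³`
extends by `Γ₄ = 0`, and extendability is transported along diffeomorphisms and `ULift`.  This
is the case `p = 0` (`Y_0 = D⁴`) of Laudenbach–Poénaru's theorem, where it *is* `Γ₄ = 0`.
[cite: CerfDiffeoSphere1968, Introduction (2nd par.); Ch. I §1, Théorème 1, Corollaire 1]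
[cite: Kosinski1993, VI (6.6), (11.4)(c)] -/
theorem BoundaryData.diffeoExtends_of_handleCount_one_zero_of_cerf
    (hC : cerf_diffeomorph_sphere_three_extends_ball)
    {V : Type u} [TopologicalSpace V] [T2Space V] [SecondCountableTopology V] [CompactSpace V]
    [ConnectedSpace V] [ChartedSpace (EuclideanHalfSpace 4) V] [IsManifold (𝓡∂ 4) ∞ V]
    (hk : HasHandleDecomposition 3 V (handleCount 1 0)) (ho : IsOrientable (𝓡∂ 4) V)
    (b : BoundaryData (𝓡∂ 4) V (𝓡 3)) (ψ : b.carrier ≃ₘ⟮𝓡 3, 𝓡 3⟯ b.carrier) :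
    b.DiffeoExtends ψ := by
  haveI : Fact (isSmoothEmbedding_sphereInclusion' 3) :=
    ⟨isSmoothEmbedding_sphereInclusion'_holds 3⟩
  haveI : ConnectedSpace (Metric.closedBall (0 : EuclideanSpace ℝ (Fin 4)) 1) :=
    connectedSpace_closedBall 3
  -- the model `ULift 𝔻⁴` of type `(1, 0)` in universe `u`
  have hkD : HasHandleDecomposition 3
      (ULift.{u} (Metric.closedBall (0 : EuclideanSpace ℝ (Fin 4)) 1)) (handleCount 1 0) :=
    ManifoldULift.hasHandleDecomposition (hasHandleDecomposition_closedBall 3)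
  have hoD :
      IsOrientable (𝓡∂ 4) (ULift.{u} (Metric.closedBall (0 : EuclideanSpace ℝ (Fin 4)) 1)) :=
    ManifoldULift.isOrientable (isOrientable_closedBall 3)
  obtain ⟨φ⟩ := nonempty_diffeomorph_of_hasHandleDecomposition_handleCount_one_of_oneHandle
    oneHandle_nonempty_diffeomorph_holds 0 V
    (ULift.{u} (Metric.closedBall (0 : EuclideanSpace ℝ (Fin 4)) 1)) hk ho hkD hoD
  -- its boundary datum `ULift 𝕊³`; the transports `e = ∂φ : ∂V ≅ ULift 𝕊³`, `D : ULift 𝕊³ ≅ 𝕊³`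
  set bD : BoundaryData (𝓡∂ 4) (ULift.{u} (Metric.closedBall (0 : EuclideanSpace ℝ (Fin 4)) 1))
    (𝓡 3) := (closedBallBoundaryData 3).ulift
  set e : b.carrier ≃ₘ⟮𝓡 3, 𝓡 3⟯ bD.carrier := b.restrictDiffeomorph bD φ
  set D : bD.carrier ≃ₘ⟮𝓡 3, 𝓡 3⟯ (Metric.sphere (0 : EuclideanSpace ℝ (Fin 4)) 1) :=
    ManifoldULift.diffeomorph (𝓡 3) (Metric.sphere (0 : EuclideanSpace ℝ (Fin 4)) 1) ∞
  -- `ψ` transported to `ULift 𝕊³` and down to `𝕊³`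
  set ψ₁ : bD.carrier ≃ₘ⟮𝓡 3, 𝓡 3⟯ bD.carrier := (e.symm.trans ψ).trans e with hψ₁
  set ψ₀ := (D.symm.trans ψ₁).trans D
  -- `Γ₄ = 0`: `ψ₀` extends over `𝔻⁴`
  have h₀ : (closedBallBoundaryData 3).DiffeoExtends ψ₀ := by
    obtain ⟨Φ, hΦ⟩ := hC ψ₀
    exact ⟨Φ, funext fun z => hΦ z⟩
  -- lift the extension to `ULift 𝔻⁴`; the lifted boundary map `up ∘ ψ₀ ∘ down` is `ψ₁`
  have h₁ : bD.DiffeoExtends ((closedBallBoundaryData 3).uliftDiffeo.{0, u} ψ₀) := h₀.ulift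
  have heq₁ : (closedBallBoundaryData 3).uliftDiffeo.{0, u} ψ₀ = ψ₁ :=
    Diffeomorph.ext fun x => rfl
  rw [heq₁] at h₁
  -- conjugate back to `V` along `φ`
  have h₂ : b.DiffeoExtends ((e.trans ψ₁).trans e.symm) := h₁.conj φ
  have heq₂ : (e.trans ψ₁).trans e.symm = ψ :=
    Diffeomorph.ext fun x => by simp [hψ₁, Diffeomorph.coe_trans]
  rwa [heq₂] at h₂

/-! ### §2 Cerf's reduction: the based orientation-preserving case of `Γ₄ = 0` suffices -/

/-- **`Γ₄ = 0` from its based orientation-preserving case.**  Suppose every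
self-diffeomorphism of `𝕊³` that preserves every smooth orientation and fixes some point extends
over `𝔻⁴`.  Then every self-diffeomorphism `φ` of `𝕊³` extends over `𝔻⁴`
(`cerf_diffeomorph_sphere_three_extends_ball`).  If `φ` preserves every orientation: move
`φ e₀` back to `e₀ = sphereBasePoint 3` by a diffeomorphism `P` diffeotopic to the identity
(homogeneity of the connected `𝕊³`, `Diffeomorph.exists_isDiffeotopicToId_apply_eq_euclidean`;
Hirsch (1976), Ch. 8 §3, Thm. 3.1), which preserves every orientation
(`Diffeomorph.IsDiffeotopicToId.isOrientationPreserving`) and extends by Cerf's Lemme 2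
(`ExtendsOverBall.of_isDiffeotopicToId`); `P ∘ φ` is based, hence extends, and
`φ = P⁻¹ ∘ (P ∘ φ)`.  Otherwise `φ` reverses some, hence every, orientation of the connected
`𝕊³` (`Diffeomorph.isOrientationPreserving_or_isOrientationReversing_holds`,
`SmoothOrientation.eq_or_eq_neg_of_connectedSpace_holds`), so `ρ ∘ φ` preserves every
orientation for the hyperplane reflection `ρ = sphereReflection e₀`
(`sphereReflection_isOrientationReversing_of_ne_zero`), which extends linearly
(`extendsOverBall_sphereReflection`); and `φ = ρ⁻¹ ∘ (ρ ∘ φ)`.  This is Cerf's passage from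
Corollaire 1 to the orientation-free statement of his Introduction.
[cite: CerfDiffeoSphere1968, Introduction (2nd par.); Ch. I §1, Lemme 2, Théorème 1, Corollaire 1]
[cite: HirschDT1976, Ch. 4 §4; Ch. 8 §3, Thm. 3.1] -/
theorem cerf_diffeomorph_sphere_three_extends_ball_of_forall_apply_eq
    (H : ∀ ψ : (Metric.sphere (0 : EuclideanSpace ℝ (Fin 4)) 1) ≃ₘ⟮𝓡 3, 𝓡 3⟯
        (Metric.sphere (0 : EuclideanSpace ℝ (Fin 4)) 1),
      (∀ o : SmoothOrientation (𝓡 3) (Metric.sphere (0 : EuclideanSpace ℝ (Fin 4)) 1),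
        ψ.IsOrientationPreserving o o) →
      ∀ z₀ : Metric.sphere (0 : EuclideanSpace ℝ (Fin 4)) 1, ψ z₀ = z₀ → ExtendsOverBall 3 ψ) :
    cerf_diffeomorph_sphere_three_extends_ball := by
  haveI : ConnectedSpace (Metric.sphere (0 : EuclideanSpace ℝ (Fin 4)) 1) :=
    connectedSpace_sphere_three
  -- unbased orientation-preserving case
  have hunbased : ∀ χ : (Metric.sphere (0 : EuclideanSpace ℝ (Fin 4)) 1) ≃ₘ⟮𝓡 3, 𝓡 3⟯
      (Metric.sphere (0 : EuclideanSpace ℝ (Fin 4)) 1),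
      (∀ o : SmoothOrientation (𝓡 3) (Metric.sphere (0 : EuclideanSpace ℝ (Fin 4)) 1),
        χ.IsOrientationPreserving o o) → ExtendsOverBall 3 χ := by
    intro χ hop
    obtain ⟨P, hPiso, hPz⟩ :=
      Diffeomorph.exists_isDiffeotopicToId_apply_eq_euclidean 3
        (Metric.sphere (0 : EuclideanSpace ℝ (Fin 4)) 1) (χ (sphereBasePoint 3))
        (sphereBasePoint 3)
    have hPext : ExtendsOverBall 3 P := ExtendsOverBall.of_isDiffeotopicToId hPiso
    have hop' : ∀ o : SmoothOrientation (𝓡 3) (Metric.sphere (0 : EuclideanSpace ℝ (Fin 4)) 1),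
        (χ.trans P).IsOrientationPreserving o o :=
      fun o => isOrientationPreserving_trans_sphere_three (hop o) (hPiso.isOrientationPreserving o)
    have hz : (χ.trans P) (sphereBasePoint 3) = sphereBasePoint 3 := by
      simp [Diffeomorph.coe_trans, hPz]
    exact (H (χ.trans P) hop' (sphereBasePoint 3) hz).of_trans_of_right' hPext
  intro φ
  by_cases hop : ∀ o : SmoothOrientation (𝓡 3) (Metric.sphere (0 : EuclideanSpace ℝ (Fin 4)) 1),
      φ.IsOrientationPreserving o o
  · exact hunbased φ hop
  · -- `φ` reverses some, hence every, orientation: compose with a hyperplane reflection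
    obtain ⟨o, hno⟩ := not_forall.mp hop
    have hrev : φ.IsOrientationReversing o o :=
      (Diffeomorph.isOrientationPreserving_or_isOrientationReversing_holds φ (by simp) o
        o).resolve_left hno
    set ρ : (Metric.sphere (0 : EuclideanSpace ℝ (Fin 4)) 1) ≃ₘ⟮𝓡 3, 𝓡 3⟯
        (Metric.sphere (0 : EuclideanSpace ℝ (Fin 4)) 1) := sphereReflection (sphereBasePoint 3)
    have hρ : ∀ o' : SmoothOrientation (𝓡 3) (Metric.sphere (0 : EuclideanSpace ℝ (Fin 4)) 1),
        ρ.IsOrientationReversing o' o' := fun o' =>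
      sphereReflection_isOrientationReversing_of_ne_zero three_ne_zero (sphereBasePoint 3) o'
    have hoo : (φ.trans ρ).IsOrientationPreserving o o := by
      have h1 : φ.IsOrientationPreserving o (-o) := hrev
      have h2 : ρ.IsOrientationPreserving (-o) o := by
        have h2' : IsOrientationPreserving (-o) (-(-o)) ⇑ρ :=
          (isOrientationPreserving_neg_neg_iff o (-o) _).mpr (hρ o)
        rwa [neg_neg] at h2'
      exact isOrientationPreserving_trans_sphere_three h1 h2
    have hop' : ∀ o' : SmoothOrientation (𝓡 3) (Metric.sphere (0 : EuclideanSpace ℝ (Fin 4)) 1),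
        (φ.trans ρ).IsOrientationPreserving o' o' := by
      intro o'
      rcases SmoothOrientation.eq_or_eq_neg_of_connectedSpace_holds o o' with rfl | rfl
      · exact hoo
      · exact (isOrientationPreserving_neg_neg_iff o o _).mpr hoo
    exact (hunbased (φ.trans ρ) hop').of_trans_of_right' (extendsOverBall_sphereReflection _)

/-! ### §3 The genus-zero slices of h₂ and of spc4.S24 (c) are equivalent to `Γ₄ = 0` -/

/-- **The genus-zero slice of h₂ implies `Γ₄ = 0`** (universe `0`).  If every
self-diffeomorphism of the boundary of every compact connected orientable smooth `4`-manifold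
of handle type `(1, 0)` which preserves every smooth orientation, fixes a point `z₀` and induces
the identity of `π₁(∂V, z₀)` extends, then every self-diffeomorphism of `S³` extends over `D⁴`:
evaluate at `V = 𝔻⁴` (`hasHandleDecomposition_closedBall`, `isOrientable_closedBall`,
`connectedSpace_closedBall`, boundary datum `closedBallBoundaryData 3` with carrier `𝕊³`), where
the `π₁` hypothesis is vacuous (`π₁(𝕊³) = 1`, Hatcher Prop. 1.14,
`simplyConnectedSpace_euclideanSphere`), and conclude by Cerf's reduction
`cerf_diffeomorph_sphere_three_extends_ball_of_forall_apply_eq`.  Sharpens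
`cerf_diffeomorph_sphere_three_extends_ball_of_laudenbachPoenaru_diffeoExtends`
(`SPC4HandlesThmAImpliesCerf.lean`), whose hypothesis is h₂ in all genera.
[cite: LaudenbachPoenaruBSMF1972, §2, proof of Thm. A, pp. 341–342 (case p = 0)]
[cite: CerfDiffeoSphere1968, Introduction (2nd par.); Ch. I §1, Théorème 1, Corollaire 1]
[cite: HatcherAT2002, Prop. 1.14] -/
theorem cerf_diffeomorph_sphere_three_extends_ball_of_genusZero
    (h : ∀ (V : Type) [TopologicalSpace V] [T2Space V] [SecondCountableTopology V]
      [CompactSpace V] [ConnectedSpace V] [ChartedSpace (EuclideanHalfSpace 4) V]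
      [IsManifold (𝓡∂ 4) ∞ V] (_ : HasHandleDecomposition 3 V (handleCount 1 0))
      (_ : IsOrientable (𝓡∂ 4) V) (b : BoundaryData (𝓡∂ 4) V (𝓡 3))
      (ψ : b.carrier ≃ₘ⟮𝓡 3, 𝓡 3⟯ b.carrier)
      (_ : ∀ o : SmoothOrientation (𝓡 3) b.carrier, ψ.IsOrientationPreserving o o)
      (z₀ : b.carrier) (hz : ψ z₀ = z₀)
      (_ : ∀ a : FundamentalGroup b.carrier z₀,
        FundamentalGroup.mapOfEq (⟨ψ, ψ.continuous⟩ : C(b.carrier, b.carrier)) hz a = a),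
      b.DiffeoExtends ψ) :
    cerf_diffeomorph_sphere_three_extends_ball := by
  refine cerf_diffeomorph_sphere_three_extends_ball_of_forall_apply_eq fun ψ hop z₀ hz => ?_
  haveI : Fact (isSmoothEmbedding_sphereInclusion' 3) :=
    ⟨isSmoothEmbedding_sphereInclusion'_holds 3⟩
  haveI : ConnectedSpace (Metric.closedBall (0 : EuclideanSpace ℝ (Fin 4)) 1) :=
    connectedSpace_closedBall 3
  -- `π₁(𝕊³) = 1`: the `π₁` hypothesis is vacuous (the carrier of the boundary datum is `𝕊³`)
  haveI : SimplyConnectedSpace (Metric.sphere (0 : EuclideanSpace ℝ (Fin 4)) 1) :=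
    Literature.AlgebraicTopology.FundamentalGroup.simplyConnectedSpace_euclideanSphere 3
      (by norm_num)
  have hπ : ∀ a : FundamentalGroup (Metric.sphere (0 : EuclideanSpace ℝ (Fin 4)) 1) z₀,
      FundamentalGroup.mapOfEq
        (⟨ψ, ψ.continuous⟩ : C(Metric.sphere (0 : EuclideanSpace ℝ (Fin 4)) 1,
          Metric.sphere (0 : EuclideanSpace ℝ (Fin 4)) 1)) hz a = a :=
    fun a => Subsingleton.elim _ _
  obtain ⟨Φ, hΦ⟩ := h (Metric.closedBall (0 : EuclideanSpace ℝ (Fin 4)) 1)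
    (hasHandleDecomposition_closedBall 3) (isOrientable_closedBall 3) (closedBallBoundaryData 3)
    ψ hop z₀ hz hπ
  exact ⟨Φ, fun z => congrFun hΦ z⟩

/-- **`Γ₄ = 0` ⟺ h₂ in genus zero** (universe `0`): Cerf's theorem
`cerf_diffeomorph_sphere_three_extends_ball` is equivalent to the genus-zero slice of
Laudenbach–Poénaru's orientation-preserving extension fact
`laudenbachPoenaru_diffeoExtends_of_isOrientationPreserving` — its body with the binder
`IsHandlebodyOfIndexLE 3 1 V` specialised to `HasHandleDecomposition 3 V (handleCount 1 0)`
(`BoundaryData.diffeoExtends_of_handleCount_one_zero_of_cerf`,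
`cerf_diffeomorph_sphere_three_extends_ball_of_genusZero`).  For `p = 0` Théorème A of
Laudenbach–Poénaru reads `D⁴ ∪_h D⁴ ≅ S⁴` for every `h`, i.e. `Γ₄ = 0`.
[cite: LaudenbachPoenaruBSMF1972, Thm. A (p. 337) and §2, pp. 341–342 (case p = 0)]
[cite: CerfDiffeoSphere1968, Introduction (2nd par.); Ch. I §1, Théorème 1, Corollaire 1] -/
theorem cerf_iff_laudenbachPoenaru_diffeoExtends_genusZero :
    cerf_diffeomorph_sphere_three_extends_ball ↔
      ∀ (V : Type) [TopologicalSpace V] [T2Space V] [SecondCountableTopology V]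
        [CompactSpace V] [ConnectedSpace V] [ChartedSpace (EuclideanHalfSpace 4) V]
        [IsManifold (𝓡∂ 4) ∞ V] (_ : HasHandleDecomposition 3 V (handleCount 1 0))
        (_ : IsOrientable (𝓡∂ 4) V) (b : BoundaryData (𝓡∂ 4) V (𝓡 3))
        (ψ : b.carrier ≃ₘ⟮𝓡 3, 𝓡 3⟯ b.carrier)
        (_ : ∀ o : SmoothOrientation (𝓡 3) b.carrier, ψ.IsOrientationPreserving o o)
        (z₀ : b.carrier) (hz : ψ z₀ = z₀)
        (_ : ∀ a : FundamentalGroup b.carrier z₀,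
          FundamentalGroup.mapOfEq (⟨ψ, ψ.continuous⟩ : C(b.carrier, b.carrier)) hz a = a),
        b.DiffeoExtends ψ :=
  ⟨fun hC _ _ _ _ _ _ _ _ hk ho b ψ _ _ _ _ =>
      BoundaryData.diffeoExtends_of_handleCount_one_zero_of_cerf hC hk ho b ψ,
    cerf_diffeomorph_sphere_three_extends_ball_of_genusZero⟩

/-- **`Γ₄ = 0` ⟺ the Laudenbach–Poénaru extension fact in genus zero** (universe `0`): Cerf's
theorem is equivalent to the genus-zero slice of spc4.S24 (c),
`exists_diffeomorph_comp_incl_eq` (every boundary diffeomorphism of a compact connected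
orientable `4`-manifold of handle type `(1, 0)` extends), with no orientation, base-point or
`π₁` hypothesis — these cost nothing at `∂V ≅ S³`
(`cerf_diffeomorph_sphere_three_extends_ball_of_forall_apply_eq`).
[cite: LaudenbachPoenaruBSMF1972, Thm. A (p. 337), case p = 0]
[cite: CerfDiffeoSphere1968, Introduction (2nd par.); Ch. I §1, Théorème 1, Corollaire 1] -/
theorem cerf_iff_diffeoExtends_genusZero :
    cerf_diffeomorph_sphere_three_extends_ball ↔
      ∀ (V : Type) [TopologicalSpace V] [T2Space V] [SecondCountableTopology V]
        [CompactSpace V] [ConnectedSpace V] [ChartedSpace (EuclideanHalfSpace 4) V]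
        [IsManifold (𝓡∂ 4) ∞ V] (_ : HasHandleDecomposition 3 V (handleCount 1 0))
        (_ : IsOrientable (𝓡∂ 4) V) (b : BoundaryData (𝓡∂ 4) V (𝓡 3))
        (ψ : b.carrier ≃ₘ⟮𝓡 3, 𝓡 3⟯ b.carrier), b.DiffeoExtends ψ :=
  ⟨fun hC _ _ _ _ _ _ _ _ hk ho b ψ =>
      BoundaryData.diffeoExtends_of_handleCount_one_zero_of_cerf hC hk ho b ψ,
    fun h => cerf_diffeomorph_sphere_three_extends_ball_of_genusZero
      fun V _ _ _ _ _ _ _ hk ho b ψ _ _ _ _ => h V hk ho b ψ⟩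

/-- **h₂ in genus zero from `Γ₄ = 0`, every universe** — the literal `p = 0` instance of the
named fact `laudenbachPoenaru_diffeoExtends_of_isOrientationPreserving` (its three extra
hypotheses being unnecessary in genus zero,
`BoundaryData.diffeoExtends_of_handleCount_one_zero_of_cerf`).  Once
`cerf_diffeomorph_sphere_three_extends_ball` is discharged, what remains of h₂ is the case of
`1`-handlebodies with at least one `1`-handle (Laudenbach–Poénaru (1972), §2, pp. 341–342,
with Lemma 3 and Laudenbach (1973), §5).
[cite: LaudenbachPoenaruBSMF1972, §2, proof of Thm. A, pp. 341–342 (case p = 0)]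
[cite: CerfDiffeoSphere1968, Ch. I §1, Théorème 1, Corollaire 1] -/
theorem laudenbachPoenaru_diffeoExtends_of_isOrientationPreserving_genusZero_of_cerf
    (hC : cerf_diffeomorph_sphere_three_extends_ball)
    (V : Type u) [TopologicalSpace V] [T2Space V] [SecondCountableTopology V] [CompactSpace V]
    [ConnectedSpace V] [ChartedSpace (EuclideanHalfSpace 4) V] [IsManifold (𝓡∂ 4) ∞ V]
    (hk : HasHandleDecomposition 3 V (handleCount 1 0)) (ho : IsOrientable (𝓡∂ 4) V)
    (b : BoundaryData (𝓡∂ 4) V (𝓡 3)) (ψ : b.carrier ≃ₘ⟮𝓡 3, 𝓡 3⟯ b.carrier)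
    (_hop : ∀ o : SmoothOrientation (𝓡 3) b.carrier, ψ.IsOrientationPreserving o o)
    (z₀ : b.carrier) (hz : ψ z₀ = z₀)
    (_hπ : ∀ a : FundamentalGroup b.carrier z₀,
      FundamentalGroup.mapOfEq (⟨ψ, ψ.continuous⟩ : C(b.carrier, b.carrier)) hz a = a) :
    b.DiffeoExtends ψ :=
  BoundaryData.diffeoExtends_of_handleCount_one_zero_of_cerf hC hk ho b ψ

end Literature.Topology.FourManifolds

end
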